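import Summits.ResolutionOfSingularities.ResolutionOfSingularities.Theorems.EquisingularLiftEquisingularLiftNatNoseTowerBDoublePrimeOfFact
import Summits.ResolutionOfSingularities.ResolutionOfSingularities.Theorems.EquisingularLiftEquisingularLiftNatTowerBTriplePrimeRoundClosure
import Summits.ResolutionOfSingularities.ResolutionOfSingularities.Theorems.EquisingularLiftEquisingularLiftNatTowerBTriplePrimePointStepsFE
import Summits.ResolutionOfSingularities.ResolutionOfSingularities.Theorems.EquisingularLiftCampaignW45bULTSpecialFibrePersists
import HarnessLib

/-!
# [OURS · L1 W4.5(b) · EL♮(3) · T23-A‴] HSUB‴(ReachNoseTowerB‴)₃ — THE ENGINE OF THE T23-A‴ NOSE RUNG⁗ (`stub_elnat_defNoseTowerBTriplePrimeResolutionThree`)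
# = p617697 `hsub_reachNoseTowerBDoublePrime_of_fact` re-cut over the A‴ step predicates `TowerPtRegB₄` / `TowerPtRamB₄` / `TowerRoundBTriplePrime`
# (res-L1-w45b-lead-2 `…NatTowerRoundBTriplePrimeDefs` p627089 = my SIG 63338a4ddb1b01c8) with the three closures of this seat
# (`Tower.towerPtRegB₄_invB₁_FE` / `Tower.towerPtRamB₄_invB₁_FE` p627628, `Tower.towerRoundBTriplePrime_invB₄_of_fact'` p627682)

res-L1-w45b-stub-4 g11 (T23-A‴ engine owner; engine word v1.2 FINAL `L/res-L1-w45b-stub-4/T23Atriple-ENGINE-WORD-v1.md` d02b1fbd6b6fb5d2, desk R28).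
OURS; NOT a statement of any manuscript ([Hironaka2017] is a candidate under adjudication, nothing of it is asserted); AI-written, weaker than expert review.
No `sorry`; standard axioms; DEF-FREE; `--supports stmt-ResolutionOfSingularities-20148 --as helper`. Binders = p617697 VERBATIM; the conclusion's closure
hypothesis ranges over the ₄ predicates and carries `∃ Es' Ns'`, matching `ReachNoseTowerBTriplePrime` (lead-2 `…NatTowerReachSsDefs`, seed lists `[] []`).
THE ONE NEW STEP: the seed must be MODEL-CARRYING (`Tower.InvB₄`, no `NoRound` escape) — the nose's exceptional surface `υ⁻¹Z` has image `Z` (a blow-up of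
an integral scheme along a non-zero ideal is surjective, `surjective_of_isBlowup`), which is infinite, so `¬ NoRound` and res-L1-w45b-stub-2's
`Tower.exc₄_of_exc₃_of_not_noRound` (p625145) upgrades the `Inv₃` seed of `Tower.inv₂_noseSeed'` to `Tower.InvB₄ … [] [] ∅` (`Tower.invB₄_nil_of_inv₃`).
[cite: StacksProject, Tag 02NS and Tag 02OS] [cite: Liu2002, Thm. 8.1.19]
-/

set_option linter.dupNamespace false -- mandated namespace `Summit.<Summit>.<Problem>` of this single-conjunct summit
set_option linter.overlappingInstances false -- signatures carry `[IsDomain O] [IsDiscreteValuationRing O]`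

noncomputable section

open CategoryTheory CategoryTheory.Limits AlgebraicGeometry TopologicalSpace Topology IsLocalRing
open Literature.AlgebraicGeometry.Resolution
open AlgebraicGeometry.Scheme.IdealSheafData
open Summit.ResolutionOfSingularities.ResolutionOfSingularities.Theses.EquisingularLift.Split
open Summit.ResolutionOfSingularities.ResolutionOfSingularities.Cruxes.EquisingularLift.StrataSplit

namespace Summit.ResolutionOfSingularities.ResolutionOfSingularities.Cruxes.EquisingularLiftNat.Sections

/-- **HSUB″(ReachNoseTowerB″)₃ — the engine of DEF-NOSE-TOWER-B″** (module docstring). [cite: GortzWedhorn2020, Prop. 13.91 and (13.19)]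
[cite: Liu2002, §8.1 and Thm. 8.1.19] [OURS · L1 W4.5b · T23-A″ engine] toward `stub_elnat_defNoseTowerBDoublePrimeResolutionThree`; NOT a statement of the manuscript. -/
theorem hsub_reachNoseTowerBTriplePrime_of_fact (k : Type) [Field k]
    (O : Type) [CommRing O] [IsDomain O] [IsDiscreteValuationRing O] [IsAdicComplete (IsLocalRing.maximalIdeal O) O]
    [IsAlgClosed (IsLocalRing.ResidueField O)] (θ : O →+* k) (hθ : Function.Surjective θ)
    (P : Scheme.{0}) (q : P ⟶ Spec (.of O)) (Y : Set P) (Ch : ∀ X' : Scheme.{0}, (X' ⟶ P) → Set X' → Prop)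
    (hChStep : ∀ (X' X'' : Scheme.{0}) (σ' : X' ⟶ P) (S' : Set X') (C : X'.IdealSheafData) (τ : X'' ⟶ X'),
      Ch X' σ' S' → IsBlowup τ C → Scheme.IsRegular C.subscheme → Flat (C.subschemeι ≫ σ' ≫ q) →
      σ' '' (C.support : Set X') ⊆ {y | ¬ IsGenericPoint y Y} → (C.support : Set X') ∩ (σ' ≫ q) ⁻¹' {IsLocalRing.closedPoint O} ⊆ S' →
      Ch X'' (τ ≫ σ') (closure (τ ⁻¹' (S' \ (C.support : Set X')))))
    (hChSplit : ∀ (X' : Scheme.{0}) (σ' : X' ⟶ P) (S' : Set X'), Ch X' σ' S' → Chain P Y X' σ' S')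
    (hYsp : Y ⊆ q ⁻¹' {IsLocalRing.closedPoint O}) (hYirr : IsIrreducible Y) (hYcl : IsClosed Y) (hPint : IsIntegral P)
    (hPnoeth : IsLocallyNoetherian P) (hPreg : Scheme.IsRegular P) (hqprop : IsProper q) (hqsm : SmoothOfRelativeDimension 3 q)
    -- the stage before the nose and its model
    (X' : Scheme.{0}) (σ' : X' ⟶ P) (S' : Set X') (_hCh' : Ch X' σ' S') (_hX'int : IsIntegral X') (hX'noeth : IsLocallyNoetherian X')
    (hX'reg : Scheme.IsRegular X') (_hX'dom : IsDominant (σ' ≫ q)) (F₁ : Scheme.{0}) (hF₁ : IsIntegral F₁) (j : F₁ ⟶ X')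
    (t : F₁ ⟶ Spec (.of k)) (hsq : IsPullback j t (σ' ≫ q) (Spec.map (CommRingCat.ofHom θ))) (T₁ : Set F₁) (_hT₁cl : IsClosed T₁)
    (_hT₁irr : IsIrreducible T₁) (_hjT₁ : j '' T₁ = S')
    -- the NOSE block
    (Z : Set F₁) (hZ : IsClosed Z) (_hZT₁ : Z ⊆ T₁) (hT₁Z : ¬ (T₁ ⊆ Z)) (hZinf : Z.Infinite)
    (hZdim : ∀ z : ↥(redSub F₁ Z hZ), IsClosed ({z} : Set ↥(redSub F₁ Z hZ)) →
      ringKrullDim ((redSub F₁ Z hZ).presheaf.stalk z) = ((1 : ℕ) : WithBot ℕ∞))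
    (C : X'.IdealSheafData) (_hCsm : Smooth (C.subschemeι ≫ σ' ≫ q)) (hCreg : Scheme.IsRegular C.subscheme) (hCfl : Flat (C.subschemeι ≫ σ' ≫ q))
    (hCj : C.comap j = vanishingIdeal (⟨Z, hZ⟩ : Closeds F₁)) (hCoff : ∀ c ∈ (C.support : Set X'), ¬ IsGenericPoint (σ' c) Y)
    (X₁ : Scheme.{0}) (τ₁ : X₁ ⟶ X') (hτ₁ : IsBlowup τ₁ C) (hX₁int : IsIntegral X₁) (hX₁noeth : IsLocallyNoetherian X₁)
    (hX₁reg : Scheme.IsRegular X₁) (hX₁dom : IsDominant ((τ₁ ≫ σ') ≫ q)) (F₂ : Scheme.{0}) (hF₂ : IsIntegral F₂) (υ : F₂ ⟶ F₁)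
    (hυ : IsBlowup υ (vanishingIdeal (⟨Z, hZ⟩ : Closeds F₁))) (j₂ : F₂ ⟶ X₁) (t₂ : F₂ ⟶ Spec (.of k))
    (hsq₂ : IsPullback j₂ t₂ ((τ₁ ≫ σ') ≫ q) (Spec.map (CommRingCat.ofHom θ))) (hcomm : j₂ ≫ τ₁ = υ ≫ j)
    (_hexc : (C.comap τ₁).comap j₂ = (vanishingIdeal (⟨Z, hZ⟩ : Closeds F₁)).comap υ)
    (hirr₂ : IsIrreducible (closure (υ ⁻¹' (T₁ \ Z)))) (hCh₁ : Ch X₁ (τ₁ ≫ σ') (j₂ '' closure (υ ⁻¹' (T₁ \ Z))))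
    -- ===================== THE ONE NAMED INPUT: (T-k), the registered NEED-FACT instantiated over `q` =====================
    -- (T-k) the embedded-curve lift at every stage / exceptional surface over `q` (res-L1-w45b-lead-2 …NatTowerRoundFourDefs p594791)
    (hFact : EmbeddedCurveLift O k θ P q) :
    -- ===================== THE CONCLUSION OF HSUB‴(ReachNoseTowerB‴)₃ =====================
    ∀ (F' : Scheme.{0}) (γ' : F' ⟶ F₂) (T' E' K' : Set F'),
      (∃ Es' Ns' : List (Set F'), ∀ R₁ : (∀ G : Scheme.{0}, (G ⟶ F₂) → Set G → Set G → List (Set G) → List (Set G) → Set G → Prop),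
        R₁ F₂ (𝟙 F₂) (closure (υ ⁻¹' (T₁ \ Z))) (υ ⁻¹' Z) [] [] ∅ → TowerPtRegB₄ F₂ R₁ → TowerPtRamB₄ F₂ R₁ →
        TowerRoundBTriplePrime F₁ F₂ υ Z hZ R₁ → R₁ F' γ' T' E' Es' Ns' K') →
      ∃ (X₉ : Scheme.{0}) (σ₉ : X₉ ⟶ P) (S₉ : Set X₉) (j₉ : F' ⟶ X₉) (t₉ : F' ⟶ Spec (.of k)),
        Ch X₉ σ₉ S₉ ∧ IsIntegral X₉ ∧ IsLocallyNoetherian X₉ ∧ Scheme.IsRegular X₉ ∧ IsDominant (σ₉ ≫ q) ∧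
        IsPullback j₉ t₉ (σ₉ ≫ q) (Spec.map (CommRingCat.ofHom θ)) ∧ j₉ '' T' = S₉ ∧ IsClosed T' ∧ IsIrreducible T' ∧ IsIntegral F' := by
  classical
  haveI := hPint
  haveI := hqprop
  haveI := hqsm
  haveI := hX'noeth
  haveI := hX₁int
  haveI := hX₁noeth
  haveI := hF₂
  haveI := hF₁
  -- the exceptional-surface datum of the engine: `O`-FLATNESS of the upstairs model of the running exceptional surface
  let FE : Tower.RuledDatum P := fun _ _ _ _ _ _ _ _ _ σ _ 𝓔 => Flat (𝓔.subschemeι ≫ σ ≫ q)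
  have hFEbirth : ∀ {X X'' : Scheme.{0}} [IsLocallyNoetherian X] (σ : X ⟶ P) (C : X.IdealSheafData) (τ : X'' ⟶ X),
      Scheme.IsRegular X → Scheme.IsRegular C.subscheme → Flat (C.subschemeι ≫ σ ≫ q) → IsBlowup τ C →
      Flat ((C.comap τ).subschemeι ≫ (τ ≫ σ) ≫ q) := by
    intro X X'' _ σ C τ hXreg hCreg hCflat hτ
    rw [Category.assoc]
    exact flat_exceptional_of_isBlowup_regularCentre O X X'' (σ ≫ q) C hXreg hCreg hCflat τ hτ
  -- `F₁` is locally Noetherian (a closed subscheme of `X'`)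
  haveI : IsClosedImmersion (Spec.map (CommRingCat.ofHom θ)) := IsClosedImmersion.spec_of_surjective _ hθ
  haveI : IsClosedImmersion j := MorphismProperty.IsStableUnderBaseChange.of_isPullback hsq.flip inferInstance
  haveI hF₁noeth : IsLocallyNoetherian F₁ := LocallyOfFiniteType.isLocallyNoetherian j
  -- INV₁‴ (B‴-tower, at the datum `FE`): `Tower.InvB₄` ∧ K-side facts ∧ the carrier-dimension datum ∧ `IsLocallyNoetherian F₉` (the V10 shape of p627628/p627682)
  let INV₁ : ∀ (F₉ : Scheme.{0}) (Z₉ : Set F₉), IsClosed Z₉ → ∀ (F₁₀ : Scheme.{0}), (F₁₀ ⟶ F₉) →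
      ∀ G : Scheme.{0}, (G ⟶ F₁₀) → Set G → Set G → List (Set G) → List (Set G) → Set G → Prop :=
    fun F₉ Z₉ hZ₉ F₁₀ υ' G γ T E Es Ns K => (Tower.InvB₄ O k θ P q Y Ch FE F₉ Z₉ hZ₉ F₁₀ υ' G γ T E Es Ns K ∧
      IsClosed K ∧ K ⊆ closure (K \ E) ∧ K ≠ Set.univ) ∧
      (∀ z : ↥(redSub F₉ Z₉ hZ₉), IsClosed ({z} : Set ↥(redSub F₉ Z₉ hZ₉)) →
        ringKrullDim ((redSub F₉ Z₉ hZ₉).presheaf.stalk z) = ((1 : ℕ) : WithBot ℕ∞)) ∧ IsLocallyNoetherian F₉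
  -- (seed): `Tower.inv₂_noseSeed'` at `FE` ⇒ `Inv₃`; the seed surface `υ⁻¹Z` maps ONTO the infinite `Z` ⇒ `¬ NoRound` ⇒ MODEL-CARRYING ⇒ `InvB₄ … [] [] ∅`
  have hseed : INV₁ F₁ Z hZ F₂ υ F₂ (𝟙 F₂) (closure (υ ⁻¹' (T₁ \ Z))) (υ ⁻¹' Z) [] [] ∅ := by
    refine ⟨?_, hZdim, hF₁noeth⟩
    obtain ⟨h₁, h₂⟩ := Tower.inv₂_noseSeed' O k θ hθ P q Y Ch FE X' σ' hX'noeth hX'reg F₁ j t hsq T₁ Z hZ hT₁Z hZinf C hCreg hCj hCoff X₁ τ₁ hτ₁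
      hX₁int hX₁noeth hX₁reg hX₁dom F₂ hF₂ υ hυ j₂ t₂ hsq₂ hcomm hirr₂ hCh₁ (hFEbirth σ' C τ₁ hX'reg hCreg hCfl hτ₁)
    have h₃ := Tower.inv₂_inv₃ O k θ P q Y Ch FE F₁ Z hZ F₂ υ F₂ (𝟙 F₂) _ _ _ h₁
    -- `¬ NoRound`: the image of `υ⁻¹Z` under `𝟙 ≫ υ` is `Z`, infinite
    have hZne : (vanishingIdeal (⟨Z, hZ⟩ : Closeds F₁) : F₁.IdealSheafData) ≠ ⊥ := fun h => by
      have hsupp : ((vanishingIdeal (⟨Z, hZ⟩ : Closeds F₁) : F₁.IdealSheafData).support : Set F₁) = Z :=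
        Scheme.IdealSheafData.coe_support_vanishingIdeal _
      rw [h, Scheme.IdealSheafData.support_bot] at hsupp
      exact hT₁Z (fun t _ => hsupp ▸ trivial)
    have hsurj : Function.Surjective υ :=
      Summit.ResolutionOfSingularities.ResolutionOfSingularities.Theorems.EquisingularLift.surjective_of_isBlowup hυ hZne
    have hno : ¬ Tower.NoRound υ F₂ (𝟙 F₂) (υ ⁻¹' Z) := by
      intro hfin
      apply hZinf
      have himg : ((𝟙 F₂ ≫ υ) '' (υ ⁻¹' Z) : Set F₁) = Z := by
        rw [Category.id_comp]
        exact Set.image_preimage_eq Z hsurj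
      simpa only [Tower.NoRound, himg] using hfin
    obtain ⟨g1, g2, g3, g4, g5, g6, g7, X, σ, S, jG, tG, hCh, hX, hXn, hXr, hdom, hsqG, hTS, hE⟩ := h₃
    exact ⟨⟨g1, g2, g3, g4, g5, g6, g7, fun F hF => by simp at hF, fun F hF => by simp at hF, X, σ, S, jG, tG, hCh, hX, hXn, hXr, hdom,
      hsqG, hTS, fun hE' => Tower.exc₄_of_exc₃_of_not_noRound O P q Y FE (hE hE') hno, fun F hF => by simp at hF⟩, h₂⟩
  -- the three step closures of the B‴ tower on `INV₁‴` (this seat, p627628 / p627682)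
  have hptreg : ∀ (F₉ : Scheme.{0}) (Z₉ : Set F₉) (hZ₉ : IsClosed Z₉) (F₁₀ : Scheme.{0}) (υ' : F₁₀ ⟶ F₉),
      TowerPtRegB₄ F₁₀ (INV₁ F₉ Z₉ hZ₉ F₁₀ υ') := fun F₉ Z₉ hZ₉ F₁₀ υ' =>
    Tower.towerPtRegB₄_invB₁_FE O k θ hθ P q Y hYsp hYirr hYcl hPnoeth hPreg Ch hChStep hChSplit F₉ Z₉ hZ₉ F₁₀ υ'
  have hptram : ∀ (F₉ : Scheme.{0}) (Z₉ : Set F₉) (hZ₉ : IsClosed Z₉) (F₁₀ : Scheme.{0}) (υ' : F₁₀ ⟶ F₉),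
      TowerPtRamB₄ F₁₀ (INV₁ F₉ Z₉ hZ₉ F₁₀ υ') := fun F₉ Z₉ hZ₉ F₁₀ υ' =>
    Tower.towerPtRamB₄_invB₁_FE O k θ hθ P q Y hYsp hYirr hYcl hPnoeth hPreg Ch hChStep hChSplit F₉ Z₉ hZ₉ F₁₀ υ'
  have hround : ∀ (F₉ : Scheme.{0}) (Z₉ : Set F₉) (hZ₉ : IsClosed Z₉) (F₁₀ : Scheme.{0}) (υ' : F₁₀ ⟶ F₉),
      TowerRoundBTriplePrime F₉ F₁₀ υ' Z₉ hZ₉ (INV₁ F₉ Z₉ hZ₉ F₁₀ υ') := fun F₉ Z₉ hZ₉ F₁₀ υ' =>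
    Tower.towerRoundBTriplePrime_invB₄_of_fact' O k θ hθ P q Y hYsp hYirr hYcl hPnoeth hPreg Ch hChStep hChSplit hFact Z₉ hZ₉ υ'
  -- the closure at `R₁ := INV₁ F₁ Z hZ F₂ υ`, then (final) := `Tower.invB₄_final ∘ And.left`
  intro F' γ' T' E' K' hcl
  obtain ⟨Es', Ns', hcl⟩ := hcl
  have h' : INV₁ F₁ Z hZ F₂ υ F' γ' T' E' Es' Ns' K' :=
    hcl (INV₁ F₁ Z hZ F₂ υ) hseed (hptreg F₁ Z hZ F₂ υ) (hptram F₁ Z hZ F₂ υ) (hround F₁ Z hZ F₂ υ)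
  exact Tower.invB₄_final O k θ P q Y Ch FE F₁ Z hZ F₂ υ F' γ' T' E' Es' Ns' K' h'.1.1


/-- **Binder-drop re-cut** (res-L1-w45b-nose-w2 NOSE WORD v1.1 (N2), 2026-08-28): the SAME theorem as `hsub_reachNoseTowerBTriplePrime_of_fact` WITHOUT the
unused hypothesis `Smooth (C.subschemeι ≫ σ' ≫ q)` on the nose centre (the proof never used it); proof script verbatim.  Original docstring:

**HSUB″(ReachNoseTowerB″)₃ — the engine of DEF-NOSE-TOWER-B″** (module docstring). [cite: GortzWedhorn2020, Prop. 13.91 and (13.19)]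
[cite: Liu2002, §8.1 and Thm. 8.1.19] [OURS · L1 W4.5b · T23-A″ engine] toward `stub_elnat_defNoseTowerBDoublePrimeResolutionThree`; NOT a statement of the manuscript. -/
theorem hsub_reachNoseTowerBTriplePrime_of_fact' (k : Type) [Field k]
    (O : Type) [CommRing O] [IsDomain O] [IsDiscreteValuationRing O] [IsAdicComplete (IsLocalRing.maximalIdeal O) O]
    [IsAlgClosed (IsLocalRing.ResidueField O)] (θ : O →+* k) (hθ : Function.Surjective θ)
    (P : Scheme.{0}) (q : P ⟶ Spec (.of O)) (Y : Set P) (Ch : ∀ X' : Scheme.{0}, (X' ⟶ P) → Set X' → Prop)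
    (hChStep : ∀ (X' X'' : Scheme.{0}) (σ' : X' ⟶ P) (S' : Set X') (C : X'.IdealSheafData) (τ : X'' ⟶ X'),
      Ch X' σ' S' → IsBlowup τ C → Scheme.IsRegular C.subscheme → Flat (C.subschemeι ≫ σ' ≫ q) →
      σ' '' (C.support : Set X') ⊆ {y | ¬ IsGenericPoint y Y} → (C.support : Set X') ∩ (σ' ≫ q) ⁻¹' {IsLocalRing.closedPoint O} ⊆ S' →
      Ch X'' (τ ≫ σ') (closure (τ ⁻¹' (S' \ (C.support : Set X')))))
    (hChSplit : ∀ (X' : Scheme.{0}) (σ' : X' ⟶ P) (S' : Set X'), Ch X' σ' S' → Chain P Y X' σ' S')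
    (hYsp : Y ⊆ q ⁻¹' {IsLocalRing.closedPoint O}) (hYirr : IsIrreducible Y) (hYcl : IsClosed Y) (hPint : IsIntegral P)
    (hPnoeth : IsLocallyNoetherian P) (hPreg : Scheme.IsRegular P) (hqprop : IsProper q) (hqsm : SmoothOfRelativeDimension 3 q)
    -- the stage before the nose and its model
    (X' : Scheme.{0}) (σ' : X' ⟶ P) (S' : Set X') (_hCh' : Ch X' σ' S') (_hX'int : IsIntegral X') (hX'noeth : IsLocallyNoetherian X')
    (hX'reg : Scheme.IsRegular X') (_hX'dom : IsDominant (σ' ≫ q)) (F₁ : Scheme.{0}) (hF₁ : IsIntegral F₁) (j : F₁ ⟶ X')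
    (t : F₁ ⟶ Spec (.of k)) (hsq : IsPullback j t (σ' ≫ q) (Spec.map (CommRingCat.ofHom θ))) (T₁ : Set F₁) (_hT₁cl : IsClosed T₁)
    (_hT₁irr : IsIrreducible T₁) (_hjT₁ : j '' T₁ = S')
    -- the NOSE block
    (Z : Set F₁) (hZ : IsClosed Z) (_hZT₁ : Z ⊆ T₁) (hT₁Z : ¬ (T₁ ⊆ Z)) (hZinf : Z.Infinite)
    (hZdim : ∀ z : ↥(redSub F₁ Z hZ), IsClosed ({z} : Set ↥(redSub F₁ Z hZ)) →
      ringKrullDim ((redSub F₁ Z hZ).presheaf.stalk z) = ((1 : ℕ) : WithBot ℕ∞))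
    (C : X'.IdealSheafData) (hCreg : Scheme.IsRegular C.subscheme) (hCfl : Flat (C.subschemeι ≫ σ' ≫ q))
    (hCj : C.comap j = vanishingIdeal (⟨Z, hZ⟩ : Closeds F₁)) (hCoff : ∀ c ∈ (C.support : Set X'), ¬ IsGenericPoint (σ' c) Y)
    (X₁ : Scheme.{0}) (τ₁ : X₁ ⟶ X') (hτ₁ : IsBlowup τ₁ C) (hX₁int : IsIntegral X₁) (hX₁noeth : IsLocallyNoetherian X₁)
    (hX₁reg : Scheme.IsRegular X₁) (hX₁dom : IsDominant ((τ₁ ≫ σ') ≫ q)) (F₂ : Scheme.{0}) (hF₂ : IsIntegral F₂) (υ : F₂ ⟶ F₁)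
    (hυ : IsBlowup υ (vanishingIdeal (⟨Z, hZ⟩ : Closeds F₁))) (j₂ : F₂ ⟶ X₁) (t₂ : F₂ ⟶ Spec (.of k))
    (hsq₂ : IsPullback j₂ t₂ ((τ₁ ≫ σ') ≫ q) (Spec.map (CommRingCat.ofHom θ))) (hcomm : j₂ ≫ τ₁ = υ ≫ j)
    (_hexc : (C.comap τ₁).comap j₂ = (vanishingIdeal (⟨Z, hZ⟩ : Closeds F₁)).comap υ)
    (hirr₂ : IsIrreducible (closure (υ ⁻¹' (T₁ \ Z)))) (hCh₁ : Ch X₁ (τ₁ ≫ σ') (j₂ '' closure (υ ⁻¹' (T₁ \ Z))))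
    -- ===================== THE ONE NAMED INPUT: (T-k), the registered NEED-FACT instantiated over `q` =====================
    -- (T-k) the embedded-curve lift at every stage / exceptional surface over `q` (res-L1-w45b-lead-2 …NatTowerRoundFourDefs p594791)
    (hFact : EmbeddedCurveLift O k θ P q) :
    -- ===================== THE CONCLUSION OF HSUB‴(ReachNoseTowerB‴)₃ =====================
    ∀ (F' : Scheme.{0}) (γ' : F' ⟶ F₂) (T' E' K' : Set F'),
      (∃ Es' Ns' : List (Set F'), ∀ R₁ : (∀ G : Scheme.{0}, (G ⟶ F₂) → Set G → Set G → List (Set G) → List (Set G) → Set G → Prop),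
        R₁ F₂ (𝟙 F₂) (closure (υ ⁻¹' (T₁ \ Z))) (υ ⁻¹' Z) [] [] ∅ → TowerPtRegB₄ F₂ R₁ → TowerPtRamB₄ F₂ R₁ →
        TowerRoundBTriplePrime F₁ F₂ υ Z hZ R₁ → R₁ F' γ' T' E' Es' Ns' K') →
      ∃ (X₉ : Scheme.{0}) (σ₉ : X₉ ⟶ P) (S₉ : Set X₉) (j₉ : F' ⟶ X₉) (t₉ : F' ⟶ Spec (.of k)),
        Ch X₉ σ₉ S₉ ∧ IsIntegral X₉ ∧ IsLocallyNoetherian X₉ ∧ Scheme.IsRegular X₉ ∧ IsDominant (σ₉ ≫ q) ∧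
        IsPullback j₉ t₉ (σ₉ ≫ q) (Spec.map (CommRingCat.ofHom θ)) ∧ j₉ '' T' = S₉ ∧ IsClosed T' ∧ IsIrreducible T' ∧ IsIntegral F' := by
  classical
  haveI := hPint
  haveI := hqprop
  haveI := hqsm
  haveI := hX'noeth
  haveI := hX₁int
  haveI := hX₁noeth
  haveI := hF₂
  haveI := hF₁
  -- the exceptional-surface datum of the engine: `O`-FLATNESS of the upstairs model of the running exceptional surface
  let FE : Tower.RuledDatum P := fun _ _ _ _ _ _ _ _ _ σ _ 𝓔 => Flat (𝓔.subschemeι ≫ σ ≫ q)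
  have hFEbirth : ∀ {X X'' : Scheme.{0}} [IsLocallyNoetherian X] (σ : X ⟶ P) (C : X.IdealSheafData) (τ : X'' ⟶ X),
      Scheme.IsRegular X → Scheme.IsRegular C.subscheme → Flat (C.subschemeι ≫ σ ≫ q) → IsBlowup τ C →
      Flat ((C.comap τ).subschemeι ≫ (τ ≫ σ) ≫ q) := by
    intro X X'' _ σ C τ hXreg hCreg hCflat hτ
    rw [Category.assoc]
    exact flat_exceptional_of_isBlowup_regularCentre O X X'' (σ ≫ q) C hXreg hCreg hCflat τ hτ
  -- `F₁` is locally Noetherian (a closed subscheme of `X'`)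
  haveI : IsClosedImmersion (Spec.map (CommRingCat.ofHom θ)) := IsClosedImmersion.spec_of_surjective _ hθ
  haveI : IsClosedImmersion j := MorphismProperty.IsStableUnderBaseChange.of_isPullback hsq.flip inferInstance
  haveI hF₁noeth : IsLocallyNoetherian F₁ := LocallyOfFiniteType.isLocallyNoetherian j
  -- INV₁‴ (B‴-tower, at the datum `FE`): `Tower.InvB₄` ∧ K-side facts ∧ the carrier-dimension datum ∧ `IsLocallyNoetherian F₉` (the V10 shape of p627628/p627682)
  let INV₁ : ∀ (F₉ : Scheme.{0}) (Z₉ : Set F₉), IsClosed Z₉ → ∀ (F₁₀ : Scheme.{0}), (F₁₀ ⟶ F₉) →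
      ∀ G : Scheme.{0}, (G ⟶ F₁₀) → Set G → Set G → List (Set G) → List (Set G) → Set G → Prop :=
    fun F₉ Z₉ hZ₉ F₁₀ υ' G γ T E Es Ns K => (Tower.InvB₄ O k θ P q Y Ch FE F₉ Z₉ hZ₉ F₁₀ υ' G γ T E Es Ns K ∧
      IsClosed K ∧ K ⊆ closure (K \ E) ∧ K ≠ Set.univ) ∧
      (∀ z : ↥(redSub F₉ Z₉ hZ₉), IsClosed ({z} : Set ↥(redSub F₉ Z₉ hZ₉)) →
        ringKrullDim ((redSub F₉ Z₉ hZ₉).presheaf.stalk z) = ((1 : ℕ) : WithBot ℕ∞)) ∧ IsLocallyNoetherian F₉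
  -- (seed): `Tower.inv₂_noseSeed'` at `FE` ⇒ `Inv₃`; the seed surface `υ⁻¹Z` maps ONTO the infinite `Z` ⇒ `¬ NoRound` ⇒ MODEL-CARRYING ⇒ `InvB₄ … [] [] ∅`
  have hseed : INV₁ F₁ Z hZ F₂ υ F₂ (𝟙 F₂) (closure (υ ⁻¹' (T₁ \ Z))) (υ ⁻¹' Z) [] [] ∅ := by
    refine ⟨?_, hZdim, hF₁noeth⟩
    obtain ⟨h₁, h₂⟩ := Tower.inv₂_noseSeed' O k θ hθ P q Y Ch FE X' σ' hX'noeth hX'reg F₁ j t hsq T₁ Z hZ hT₁Z hZinf C hCreg hCj hCoff X₁ τ₁ hτ₁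
      hX₁int hX₁noeth hX₁reg hX₁dom F₂ hF₂ υ hυ j₂ t₂ hsq₂ hcomm hirr₂ hCh₁ (hFEbirth σ' C τ₁ hX'reg hCreg hCfl hτ₁)
    have h₃ := Tower.inv₂_inv₃ O k θ P q Y Ch FE F₁ Z hZ F₂ υ F₂ (𝟙 F₂) _ _ _ h₁
    -- `¬ NoRound`: the image of `υ⁻¹Z` under `𝟙 ≫ υ` is `Z`, infinite
    have hZne : (vanishingIdeal (⟨Z, hZ⟩ : Closeds F₁) : F₁.IdealSheafData) ≠ ⊥ := fun h => by
      have hsupp : ((vanishingIdeal (⟨Z, hZ⟩ : Closeds F₁) : F₁.IdealSheafData).support : Set F₁) = Z :=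
        Scheme.IdealSheafData.coe_support_vanishingIdeal _
      rw [h, Scheme.IdealSheafData.support_bot] at hsupp
      exact hT₁Z (fun t _ => hsupp ▸ trivial)
    have hsurj : Function.Surjective υ :=
      Summit.ResolutionOfSingularities.ResolutionOfSingularities.Theorems.EquisingularLift.surjective_of_isBlowup hυ hZne
    have hno : ¬ Tower.NoRound υ F₂ (𝟙 F₂) (υ ⁻¹' Z) := by
      intro hfin
      apply hZinf
      have himg : ((𝟙 F₂ ≫ υ) '' (υ ⁻¹' Z) : Set F₁) = Z := by
        rw [Category.id_comp]
        exact Set.image_preimage_eq Z hsurj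
      simpa only [Tower.NoRound, himg] using hfin
    obtain ⟨g1, g2, g3, g4, g5, g6, g7, X, σ, S, jG, tG, hCh, hX, hXn, hXr, hdom, hsqG, hTS, hE⟩ := h₃
    exact ⟨⟨g1, g2, g3, g4, g5, g6, g7, fun F hF => by simp at hF, fun F hF => by simp at hF, X, σ, S, jG, tG, hCh, hX, hXn, hXr, hdom,
      hsqG, hTS, fun hE' => Tower.exc₄_of_exc₃_of_not_noRound O P q Y FE (hE hE') hno, fun F hF => by simp at hF⟩, h₂⟩
  -- the three step closures of the B‴ tower on `INV₁‴` (this seat, p627628 / p627682)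
  have hptreg : ∀ (F₉ : Scheme.{0}) (Z₉ : Set F₉) (hZ₉ : IsClosed Z₉) (F₁₀ : Scheme.{0}) (υ' : F₁₀ ⟶ F₉),
      TowerPtRegB₄ F₁₀ (INV₁ F₉ Z₉ hZ₉ F₁₀ υ') := fun F₉ Z₉ hZ₉ F₁₀ υ' =>
    Tower.towerPtRegB₄_invB₁_FE O k θ hθ P q Y hYsp hYirr hYcl hPnoeth hPreg Ch hChStep hChSplit F₉ Z₉ hZ₉ F₁₀ υ'
  have hptram : ∀ (F₉ : Scheme.{0}) (Z₉ : Set F₉) (hZ₉ : IsClosed Z₉) (F₁₀ : Scheme.{0}) (υ' : F₁₀ ⟶ F₉),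
      TowerPtRamB₄ F₁₀ (INV₁ F₉ Z₉ hZ₉ F₁₀ υ') := fun F₉ Z₉ hZ₉ F₁₀ υ' =>
    Tower.towerPtRamB₄_invB₁_FE O k θ hθ P q Y hYsp hYirr hYcl hPnoeth hPreg Ch hChStep hChSplit F₉ Z₉ hZ₉ F₁₀ υ'
  have hround : ∀ (F₉ : Scheme.{0}) (Z₉ : Set F₉) (hZ₉ : IsClosed Z₉) (F₁₀ : Scheme.{0}) (υ' : F₁₀ ⟶ F₉),
      TowerRoundBTriplePrime F₉ F₁₀ υ' Z₉ hZ₉ (INV₁ F₉ Z₉ hZ₉ F₁₀ υ') := fun F₉ Z₉ hZ₉ F₁₀ υ' =>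
    Tower.towerRoundBTriplePrime_invB₄_of_fact' O k θ hθ P q Y hYsp hYirr hYcl hPnoeth hPreg Ch hChStep hChSplit hFact Z₉ hZ₉ υ'
  -- the closure at `R₁ := INV₁ F₁ Z hZ F₂ υ`, then (final) := `Tower.invB₄_final ∘ And.left`
  intro F' γ' T' E' K' hcl
  obtain ⟨Es', Ns', hcl⟩ := hcl
  have h' : INV₁ F₁ Z hZ F₂ υ F' γ' T' E' Es' Ns' K' :=
    hcl (INV₁ F₁ Z hZ F₂ υ) hseed (hptreg F₁ Z hZ F₂ υ) (hptram F₁ Z hZ F₂ υ) (hround F₁ Z hZ F₂ υ)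
  exact Tower.invB₄_final O k θ P q Y Ch FE F₁ Z hZ F₂ υ F' γ' T' E' Es' Ns' K' h'.1.1

end Summit.ResolutionOfSingularities.ResolutionOfSingularities.Cruxes.EquisingularLiftNat.Sections

end
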